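import Literature.Computability.StringMatching.KnuthMorrisPratt
import Literature.Computability.StringMatching.PrefixTable
import Mathlib.Data.Nat.Log
import Mathlib.Algebra.BigOperators.Group.Finset.Piecewise
import Mathlib.Algebra.BigOperators.Group.Finset.Sigma
import HarnessLib

/-!
# Locating one string with successor by default: Simon's implementation of `𝒟({x})`
# (Crochemore–Hancart–Lecroq §2.7; Simon 1994; Hancart 1993)

Crochemore, Hancart and Lecroq, *Algorithms on Strings* [CrochemoreHancartLecroq2007], §2.7
"Locating one string and successor by default", with the single-string case of §2.4
("Implementation with successor by default": forward / backward arcs, shifts, Lemmas 2.20 and 2.21).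
The string-matching automaton `𝒟({x})` of the nonempty string `x` (the minimal automaton of `A*x`)
has the prefixes of `x` as states — here the state `x[0..p-1]` is the number `p ≤ |x|` — and the
transition `δ(u, a) = h(ua)`, the longest suffix of `ua` that is a prefix of `x`
(`longestSuffixPrefix` of `Literature.Computability.StringMatching.KnuthMorrisPratt`, whose
`longestSuffixPrefix_append_singleton` identifies it with the border-chain descent `nextBorder` of
`Literature.Computability.StringMatching.BorderTable`).  In the implementation `𝒟_D({x})` with the
initial state as *successor by default* only the arcs that do not enter the initial state are stored:
the **forward arcs** `(u, a, ua)` and the **backward arcs** (every other stored arc); the *shift* of an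
arc `(u, a, u')` is `|ua| - |u'|`, and `deg(u)` is the outgoing degree of the state `u` in `𝒟_D({x})`
(the number of its labeled successors).

* **Lemma 2.20** (one string). Distinct backward arcs have distinct shifts (`shift_injOn`); indeed
  (I. Simon [Simon1994StringMatching, Thm. 2]) the backward arc of shift `k` is the *return triple*
  `(k + pref[k], x[pref[k]], pref[k] + 1)` of `k`, `pref` the table of prefixes of §1.6
  (`pref_shift_of_mem_backwardArcs`, `mem_backwardArcs_of_pref`).
* **Theorem 2.39** (Simon [Simon1994StringMatching, Thm. 1]). `𝒟_D({x})` has `|x| + 1` states,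
  exactly `|x|` forward arcs and at most `|x|` backward arcs (`card_forwardArcs`,
  `card_backwardArcs_le`); hence `Σ_u deg(u) ≤ 2|x|` (`sum_deg_le`).
* **Lemma 2.21.** `deg(u) ≤ card alph(x)` (`deg_le_card_toFinset`).
* **Lemma 2.44.** `deg_x(x) = deg_x(Border(x))`; for `va ≤_pref x`, `v ≠ ε`:
  `deg_x(v) = deg_x(Border(v)) + [Border(va) = ε]`; `deg_x(ε) = 1`
  (`deg_length`, `deg_eq_deg_border_add`, `deg_zero`).
* **Lemma 2.45.** For a nonempty prefix `u` of `x`, `2|Border(u)| ≥ |u|` implies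
  `deg_x(Border(u)) = deg_x(Border²(u))` (`deg_border_eq_deg_border_border`).
* **Lemma 2.46.** `deg_x(u) ≤ ⌊log₂(|u| + 1)⌋ + 1` for `u ≺_pref x` (`deg_le_log`).
* **Theorem 2.47** (Hancart [Hancart1993]). Every state of `𝒟_D({x})` has degree at most
  `min{card alph(x), 1 + ⌊log₂ |x|⌋}` (`deg_le`); the bound is optimal: for pairwise distinct letters
  `a₁, …, a_k` with `ξ(a₁…a_{k-1}) a_k ≤_pref x`, where `ξ(ε) = ε`, `ξ(ua) = ξ(u)·a·ξ(u)`, the state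
  `ξ(a₁…a_{k-1})` has degree exactly `k` (`deg_length_xi`; Figure 2.15, `x = abacabad`, by `decide`).

Consequences for the search (Theorem 2.42: at most `2|y| - 1` letter comparisons; Corollary 2.48: delay
`O(min{card alph(x), 1 + log₂ |x|})` whatever the order of the labeled successors) are statements about
the list implementation and are not formalised here beyond the degree bound they rest on.  Simon's
example `p = abacabadabacaba` [Simon1994StringMatching, Fig. 1] (a sesquipower: exactly `|p| = 15`
backward arcs, so the bound of Theorem 2.39 is attained) is checked by `decide`.

## Main statements

* `target` (`δ(p, a) = |h(x[0..p-1]·a)|`), `target_eq_length_nextBorder`, `target_eq_succ_iff`,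
  `getElem?_of_target_pos`, `target_eq_target_border`, `target_border_of_getElem?`.
* `arcs`, `forwardArcs`, `backwardArcs`, `shift`; `card_forwardArcs`, `shift_injOn`,
  `card_backwardArcs_le`, `card_arcs_le` — Lemma 2.20 and Theorem 2.39;
  `pref_shift_of_mem_backwardArcs`, `mem_backwardArcs_of_pref` — the return set (Simon, Thm. 2).
* `succLetters`, `deg`, `deg_le_card_toFinset` (Lemma 2.21), `sum_deg_eq_card_arcs`, `sum_deg_le`.
* `deg_zero`, `deg_length`, `deg_eq_deg_border_add` (Lemma 2.44), `deg_border_eq_deg_border_border`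
  (Lemma 2.45), `deg_le_log` (Lemma 2.46), `deg_le` (Theorem 2.47).
* `xi`, `xi_append_singleton`, `length_xi`, `deg_length_xi` — optimality of Theorem 2.47.

## References

* M. Crochemore, C. Hancart, T. Lecroq, *Algorithms on Strings*, Cambridge University Press (2007),
  §2.4 (Prop. 2.19, Lemmas 2.20, 2.21) and §2.7 (Theorem 2.39, Lemmas 2.43–2.46, Theorem 2.47,
  Corollary 2.48, Figure 2.15). [CrochemoreHancartLecroq2007]
* I. Simon, *String matching algorithms and automata*, in: Results and Trends in Theoretical Computer
  Science, LNCS 812 (1994) 386–395, Theorems 1 and 2, Fig. 1. [Simon1994StringMatching]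
* C. Hancart, *On Simon's string searching algorithm*, Inform. Process. Lett. 47 (1993) 95–99 (the
  exact bound on the delay). [Hancart1993]
-/

namespace Literature.Computability.StringMatching

open List Nat Literature.Combinatorics.Words
open scoped BigOperators

variable {α : Type*} [DecidableEq α]

/-! ### The transition function of `𝒟({x})` on the states `0, 1, …, |x|` -/

/-- **The transition of the string-matching automaton `𝒟({x})`** on the state `p` (the prefix
`x[0..p-1]`) and the letter `a`: `δ(p, a) = |h(x[0..p-1]·a)|`, the length of the longest suffix of
`x[0..p-1]a` that is a prefix of `x`. [cite: CrochemoreHancartLecroq2007, §2.7 (𝒟({x})); Simon1994StringMatching, §2] -/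
def target (x : List α) (p : ℕ) (a : α) : ℕ :=
  (longestSuffixPrefix x (x.take p ++ [a])).length

/-- The state reached is the prefix of `x` of length `δ(p, a)`. [cite: CrochemoreHancartLecroq2007, §2.7 (𝒟({x}))] -/
theorem longestSuffixPrefix_take_append (x : List α) (p : ℕ) (a : α) :
    longestSuffixPrefix x (x.take p ++ [a]) = x.take (target x p a) :=
  List.prefix_iff_eq_take.mp (longestSuffixPrefix_prefix x _)

/-- `x[0..δ(p,a)-1]` is a suffix of `x[0..p-1]a` … [cite: CrochemoreHancartLecroq2007, §2.7 (𝒟({x}))] -/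
theorem take_target_suffix (x : List α) (p : ℕ) (a : α) :
    x.take (target x p a) <:+ x.take p ++ [a] := by
  rw [← longestSuffixPrefix_take_append]
  exact longestSuffixPrefix_suffix x _

/-- … and the longest prefix of `x` with this property. [cite: CrochemoreHancartLecroq2007, §2.7 (𝒟({x}))] -/
theorem length_le_target {x s : List α} {p : ℕ} {a : α} (hsx : s <+: x)
    (hs : s <:+ x.take p ++ [a]) : s.length ≤ target x p a :=
  length_le_longestSuffixPrefix hsx hs

/-- `δ(p, a) ≤ |x|`. [cite: CrochemoreHancartLecroq2007, §2.7 (𝒟({x}))] -/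
theorem target_le_length (x : List α) (p : ℕ) (a : α) : target x p a ≤ x.length :=
  (longestSuffixPrefix_prefix x _).length_le

/-- `δ(p, a) ≤ p + 1`. [cite: CrochemoreHancartLecroq2007, §2.7 (𝒟({x}))] -/
theorem target_le_succ (x : List α) (p : ℕ) (a : α) : target x p a ≤ p + 1 := by
  have h := (longestSuffixPrefix_suffix x (x.take p ++ [a])).length_le
  simp only [List.length_append, List.length_take, List.length_singleton] at h
  unfold target
  omega

/-- The state of `𝒟({x})` after reading a prefix of `x` is that prefix. [folklore] -/
private theorem longestSuffixPrefix_take (x : List α) (p : ℕ) :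
    longestSuffixPrefix x (x.take p) = x.take p :=
  (longestSuffixPrefix_suffix x (x.take p)).eq_of_length
    (le_antisymm (longestSuffixPrefix_suffix x _).length_le
      (length_le_longestSuffixPrefix (List.take_prefix p x) (List.suffix_refl _)))

/-- **The transition is the border-chain descent** of `Borders` / `Prefix-search`:
`δ(p, a) = |nextBorder x a (x[0..p-1])|`. [cite: CrochemoreHancartLecroq2007, §2.7 (𝒟({x})) and §2.6] -/
theorem target_eq_length_nextBorder (x : List α) (p : ℕ) (a : α) :
    target x p a = (nextBorder x a (x.take p)).length := by
  unfold target
  rw [longestSuffixPrefix_append_singleton, longestSuffixPrefix_take]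

omit [DecidableEq α] in
/-- The last letter of a nonempty suffix. [folklore] -/
private theorem getLast?_eq_of_suffix {s l : List α} (hs : s <:+ l) (hne : s ≠ []) :
    s.getLast? = l.getLast? := by
  obtain ⟨r, rfl⟩ := hs
  rw [List.getLast?_append]
  cases h : s.getLast? with
  | none => exact absurd (List.getLast?_eq_none_iff.mp h) hne
  | some b => rfl

/-- A stored arc enters a state whose last letter is its label: `δ(p, a) = t > 0` implies
`x[t-1] = a`. [cite: CrochemoreHancartLecroq2007, Lemma 2.20 (proof)] -/
theorem getElem?_of_target_pos {x : List α} {p : ℕ} {a : α} (h : 0 < target x p a) :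
    x[target x p a - 1]? = some a := by
  have htl : target x p a ≤ x.length := target_le_length x p a
  have hne : x.take (target x p a) ≠ [] := by
    intro e
    have := congrArg List.length e
    simp only [List.length_take, List.length_nil] at this
    omega
  have h1 : (x.take (target x p a)).getLast? = some a := by
    rw [getLast?_eq_of_suffix (take_target_suffix x p a) hne]
    simp
  rw [List.getLast?_eq_getElem?] at h1
  simp only [List.length_take, Nat.min_eq_left htl] at h1
  rw [List.getElem?_take_of_lt (by omega)] at h1
  exact h1

/-- Labels of stored arcs are letters of `x`. [cite: CrochemoreHancartLecroq2007, Lemma 2.21 (proof)] -/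
theorem mem_of_target_ne_zero {x : List α} {p : ℕ} {a : α} (h : target x p a ≠ 0) : a ∈ x :=
  List.mem_of_getElem? (getElem?_of_target_pos (Nat.pos_of_ne_zero h))

/-- A letter outside `alph(x)` leads to the initial state. [cite: CrochemoreHancartLecroq2007, Lemma 2.21 (proof)] -/
theorem target_eq_zero_of_not_mem {x : List α} {p : ℕ} {a : α} (h : a ∉ x) : target x p a = 0 := by
  by_contra hne
  exact h (mem_of_target_ne_zero hne)

/-- **Forward arcs**: `δ(p, a) = p + 1` iff `x[p] = a`. [cite: CrochemoreHancartLecroq2007, §2.4 (forward arcs)] -/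
theorem target_eq_succ_iff (x : List α) (p : ℕ) (a : α) :
    target x p a = p + 1 ↔ x[p]? = some a := by
  constructor
  · intro h
    have := getElem?_of_target_pos (x := x) (p := p) (a := a) (by omega)
    rwa [h, Nat.add_sub_cancel] at this
  · intro h
    have hp : p < x.length := (List.getElem?_eq_some_iff.mp h).1
    refine le_antisymm (target_le_succ x p a) ?_
    have ht : x.take (p + 1) = x.take p ++ [a] := by
      rw [List.take_add_one, h]
      rfl
    have := length_le_target (p := p) (a := a) (List.take_prefix (p + 1) x)
      (by rw [ht])
    simp only [List.length_take] at this
    omega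

/-- Unfolding equation of `nextBorder`. [folklore] -/
private theorem nextBorder_eq' (x : List α) (a : α) (w : List α) :
    nextBorder x a w =
      if x[w.length]? = some a then w ++ [a] else if w = [] then [] else nextBorder x a (border w) := by
  rw [nextBorder]
  simp only [dite_eq_ite]

/-- The descent reads `u` only below the length of its argument. [folklore] -/
private theorem nextBorder_congr' {B u : List α} (hB : B <+: u) (a : α) :
    ∀ w : List α, w.length < B.length → nextBorder B a w = nextBorder u a w
  | w, hw => by
    rw [nextBorder_eq' B, nextBorder_eq' u]
    have he : B[w.length]? = u[w.length]? := by
      obtain ⟨t, rfl⟩ := hB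
      rw [List.getElem?_append_left hw]
    rw [he]
    split_ifs with h1 h2
    · rfl
    · rfl
    · exact nextBorder_congr' hB a (border w) ((length_border_lt h2).trans hw)
termination_by w => w.length
decreasing_by exact length_border_lt h2

/-- `Border(x[0..p-1])` is the prefix of `x` of its length. [folklore] -/
private theorem border_take_eq_take (x : List α) (p : ℕ) :
    border (x.take p) = x.take (border (x.take p)).length :=
  List.prefix_iff_eq_take.mp ((border_prefix _).trans (List.take_prefix p x))

/-- From the initial state: `δ(ε, a) = 1` if `x[0] = a`, else `0`. [cite: CrochemoreHancartLecroq2007, Lemma 2.44 (case v = ε)] -/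
theorem target_zero (x : List α) (a : α) : target x 0 a = if x[0]? = some a then 1 else 0 := by
  rw [target_eq_length_nextBorder, List.take_zero, nextBorder_eq']
  simp only [List.length_nil]
  by_cases h : x[0]? = some a <;> simp [h]

/-- **The failure link**: on a negative comparison `x[p] ≠ a` in a state `p ≠ ε` (in particular from
the terminal state `p = |x|`), `δ(p, a) = δ(Border(x[0..p-1]), a)`.
[cite: CrochemoreHancartLecroq2007, Lemma 2.43 and Prop 2.29] -/
theorem target_eq_target_border {x : List α} {p : ℕ} {a : α} (hp : p ≤ x.length) (hp0 : 0 < p)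
    (hpa : x[p]? ≠ some a) : target x p a = target x (border (x.take p)).length a := by
  rw [target_eq_length_nextBorder, target_eq_length_nextBorder, nextBorder_eq' x a (x.take p)]
  have hl : (x.take p).length = p := by simp; omega
  have hne : x.take p ≠ [] := by
    intro e
    rw [e] at hl
    simp at hl
    omega
  rw [hl, if_neg hpa, if_neg hne, ← border_take_eq_take]

/-- From the state `Border(x[0..p-1])` the letter `x[p]` leads to `Border(x[0..p])` (Lemma 1.22
iterated: the transition of the failure state on the forward letter).
[cite: CrochemoreHancartLecroq2007, Lemma 2.44 (proof) and Lemma 1.22] -/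
theorem target_border_of_getElem? {x : List α} {p : ℕ} {a : α} (hp0 : 0 < p) (ha : x[p]? = some a) :
    target x (border (x.take p)).length a = (border (x.take (p + 1))).length := by
  have hp : p < x.length := (List.getElem?_eq_some_iff.mp ha).1
  have hl : (x.take p).length = p := by simp; omega
  have hne : x.take p ≠ [] := by
    intro e
    rw [e] at hl
    simp at hl
    omega
  have htake : x.take (p + 1) = x.take p ++ [a] := by
    rw [List.take_add_one, ha]
    rfl
  rw [htake, border_append_singleton_eq_nextBorder hne a,
    nextBorder_congr' (List.take_prefix p x) a (border (x.take p)) (length_border_lt hne),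
    target_eq_length_nextBorder, ← border_take_eq_take]

/-! ### Arcs of the implementation `𝒟_D({x})`: forward and backward arcs, shifts -/

/-- **The arcs of `𝒟_D({x})`**: the pairs `(p, a)` (state `p ≤ |x|`, letter `a` of `x`) whose
transition does not enter the initial state, which is the successor by default.
[cite: CrochemoreHancartLecroq2007, §2.4 (implementation 𝒟_D) and §2.7] -/
def arcs (x : List α) : Finset (ℕ × α) :=
  (Finset.range (x.length + 1) ×ˢ x.toFinset).filter fun e => target x e.1 e.2 ≠ 0

/-- **Forward arcs** `(u, a, ua)`. [cite: CrochemoreHancartLecroq2007, §2.4 (forward arc)] -/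
def forwardArcs (x : List α) : Finset (ℕ × α) :=
  (arcs x).filter fun e => target x e.1 e.2 = e.1 + 1

/-- **Backward arcs**: the stored arcs that are not forward, i.e. `(u, a, u')` with
`ε ≠ u' ≠ ua`. [cite: CrochemoreHancartLecroq2007, §2.4 (backward arc); Simon1994StringMatching, §2] -/
def backwardArcs (x : List α) : Finset (ℕ × α) :=
  (arcs x).filter fun e => target x e.1 e.2 ≤ e.1

/-- The **shift** `|ua| - |u'|` of the arc `(u, a, u')`. [cite: CrochemoreHancartLecroq2007, §2.4 (shift of an arc)] -/
def shift (x : List α) (e : ℕ × α) : ℕ := e.1 + 1 - target x e.1 e.2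

/-- The arcs of `𝒟_D({x})` leave the states `p ≤ |x|` with a target `≠ 0`. [cite: CrochemoreHancartLecroq2007, §2.4 (implementation 𝒟_D)] -/
theorem mem_arcs_iff {x : List α} {e : ℕ × α} :
    e ∈ arcs x ↔ e.1 ≤ x.length ∧ target x e.1 e.2 ≠ 0 := by
  simp only [arcs, Finset.mem_filter, Finset.mem_product, Finset.mem_range, List.mem_toFinset,
    Nat.lt_add_one_iff]
  constructor
  · rintro ⟨⟨h1, -⟩, h2⟩
    exact ⟨h1, h2⟩
  · rintro ⟨h1, h2⟩
    exact ⟨⟨h1, mem_of_target_ne_zero h2⟩, h2⟩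

/-- The forward arcs are the pairs `(p, x[p])`, `p < |x|`. [cite: CrochemoreHancartLecroq2007, Prop 2.19 (proof)] -/
theorem mem_forwardArcs_iff {x : List α} {e : ℕ × α} :
    e ∈ forwardArcs x ↔ x[e.1]? = some e.2 := by
  rw [forwardArcs, Finset.mem_filter, mem_arcs_iff, target_eq_succ_iff]
  constructor
  · rintro ⟨-, h⟩
    exact h
  · intro h
    have hp : e.1 < x.length := (List.getElem?_eq_some_iff.mp h).1
    refine ⟨⟨hp.le, ?_⟩, h⟩
    rw [(target_eq_succ_iff x e.1 e.2).mpr h]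
    omega

/-- Backward arcs: `0 < δ(p, a) ≤ p` (and `p ≤ |x|`). [cite: CrochemoreHancartLecroq2007, §2.4 (backward arc)] -/
theorem mem_backwardArcs_iff {x : List α} {e : ℕ × α} :
    e ∈ backwardArcs x ↔ e.1 ≤ x.length ∧ 0 < target x e.1 e.2 ∧ target x e.1 e.2 ≤ e.1 := by
  rw [backwardArcs, Finset.mem_filter, mem_arcs_iff, Nat.pos_iff_ne_zero]
  tauto

/-- Every stored arc is forward or backward, not both. [cite: CrochemoreHancartLecroq2007, §2.4 (forward and backward arcs)] -/
theorem backwardArcs_eq_filter_not (x : List α) :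
    backwardArcs x = (arcs x).filter fun e => ¬ target x e.1 e.2 = e.1 + 1 := by
  unfold backwardArcs
  refine Finset.filter_congr fun e _ => ?_
  have := target_le_succ x e.1 e.2
  constructor <;> intro h <;> omega

/-- `#arcs = #forward arcs + #backward arcs`. [cite: CrochemoreHancartLecroq2007, Prop 2.19 and Thm 2.39] -/
theorem card_arcs_eq (x : List α) :
    (arcs x).card = (forwardArcs x).card + (backwardArcs x).card := by
  rw [backwardArcs_eq_filter_not, forwardArcs]
  exact (Finset.card_filter_add_card_filter_not _).symm

/-- **Theorem 2.39, forward arcs**: `𝒟_D({x})` has exactly `|x|` forward arcs (one per nonempty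
prefix of `x`, identified by its target). [cite: CrochemoreHancartLecroq2007, Thm 2.39 and Prop 2.19; Simon1994StringMatching, Thm 1] -/
theorem card_forwardArcs (x : List α) : (forwardArcs x).card = x.length := by
  rw [← Finset.card_range x.length]
  refine Finset.card_nbij Prod.fst (fun e he => ?_) (fun e he e' he' h => ?_) (fun p hp => ?_)
  · have h := mem_forwardArcs_iff.mp (Finset.mem_coe.mp he)
    exact Finset.mem_coe.mpr (Finset.mem_range.mpr (List.getElem?_eq_some_iff.mp h).1)
  · have h1 := mem_forwardArcs_iff.mp (Finset.mem_coe.mp he)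
    have h2 := mem_forwardArcs_iff.mp (Finset.mem_coe.mp he')
    refine Prod.ext h ?_
    have : some e.2 = some e'.2 := by rw [← h1, ← h2, show e.1 = e'.1 from h]
    exact Option.some.inj this
  · have hp' : p < x.length := Finset.mem_range.mp (Finset.mem_coe.mp hp)
    exact ⟨(p, x[p]), Finset.mem_coe.mpr (mem_forwardArcs_iff.mpr (List.getElem?_eq_getElem hp')), rfl⟩

/-- The shift of a backward arc lies in `[1, |x|]`. [cite: CrochemoreHancartLecroq2007, Prop 2.19 (proof)] -/
theorem shift_mem_Icc {x : List α} {e : ℕ × α} (he : e ∈ backwardArcs x) :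
    shift x e ∈ Finset.Icc 1 x.length := by
  obtain ⟨h1, h2, h3⟩ := mem_backwardArcs_iff.mp he
  simp only [Finset.mem_Icc, shift]
  omega

/-- **The backward arc of shift `k` is the return triple of `k`** (I. Simon): if `(p, a)` is a
backward arc with target `t` and shift `k = p + 1 - t`, then `pref[k] = t - 1`, `p = k + pref[k]`
and `a = x[pref[k]]`: spelling `x` in itself from position `k` matches exactly `t - 1` letters and
stops on the letter `a` (or at the end of `x`). [cite: Simon1994StringMatching, Thm 2; CrochemoreHancartLecroq2007, Lemma 2.20 (proof)] -/
theorem pref_shift_of_mem_backwardArcs {x : List α} {e : ℕ × α} (he : e ∈ backwardArcs x) :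
    pref x (shift x e) + 1 = target x e.1 e.2 ∧ shift x e + pref x (shift x e) = e.1 ∧
      x[pref x (shift x e)]? = some e.2 := by
  obtain ⟨hp, ht0, htp⟩ := mem_backwardArcs_iff.mp he
  obtain ⟨p, a⟩ := e
  simp only at hp ht0 htp ⊢
  set t := target x p a with ht_def
  have ha : x[t - 1]? = some a := getElem?_of_target_pos ht0
  have hk : shift x (p, a) = p + 1 - t := rfl
  -- the suffix relation, letter by letter
  obtain ⟨r, hr⟩ := take_target_suffix x p a
  have hlr : r.length = p + 1 - t := by
    have := congrArg List.length hr
    simp only [List.length_append, List.length_take, List.length_singleton,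
      Nat.min_eq_left (target_le_length x p a), Nat.min_eq_left hp] at this
    omega
  have hmatch : ∀ j < t - 1, x[p + 1 - t + j]? = x[j]? := by
    intro j hj
    have h1 := congrArg (fun l => l[p + 1 - t + j]?) hr
    rw [List.getElem?_append_right (by omega), hlr, Nat.add_sub_cancel_left,
      List.getElem?_take_of_lt (by omega), List.getElem?_append_left (by simp; omega),
      List.getElem?_take_of_lt (by omega)] at h1
    exact h1.symm
  have hpref : pref x (p + 1 - t) = t - 1 := by
    refine pref_eq_of (by omega) hmatch ?_
    rcases Nat.lt_or_ge p x.length with hlt | hge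
    · right
      rw [show p + 1 - t + (t - 1) = p by omega, ha]
      intro hpa
      have := (target_eq_succ_iff x p a).mpr hpa
      omega
    · left
      omega
  rw [hk, hpref]
  refine ⟨by omega, by omega, ha⟩

/-- **Lemma 2.20** (for one string): distinct backward arcs have distinct shifts.
[cite: CrochemoreHancartLecroq2007, Lemma 2.20; Simon1994StringMatching, Thm 2] -/
theorem shift_injOn (x : List α) : Set.InjOn (shift x) (backwardArcs x) := by
  intro e he e' he' h
  obtain ⟨-, h2, h3⟩ := pref_shift_of_mem_backwardArcs (Finset.mem_coe.mp he)
  obtain ⟨-, h2', h3'⟩ := pref_shift_of_mem_backwardArcs (Finset.mem_coe.mp he')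
  rw [h] at h2 h3
  refine Prod.ext (by omega) ?_
  exact Option.some.inj (h3.symm.trans h3')

/-- **Theorem 2.39, backward arcs** (Simon): `𝒟_D({x})` has at most `|x|` backward arcs — their
shifts are distinct and lie in `[1, |x|]`. [cite: CrochemoreHancartLecroq2007, Thm 2.39 and Prop 2.19; Simon1994StringMatching, Thm 1] -/
theorem card_backwardArcs_le (x : List α) : (backwardArcs x).card ≤ x.length := by
  calc (backwardArcs x).card ≤ (Finset.Icc 1 x.length).card :=
        Finset.card_le_card_of_injOn (shift x) (fun e he => Finset.mem_coe.mpr (shift_mem_Icc he))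
          (shift_injOn x)
    _ = x.length := by simp

/-- **Theorem 2.39, size**: `𝒟_D({x})` (with its `|x| + 1` states) has at most `2|x|` arcs.
[cite: CrochemoreHancartLecroq2007, Thm 2.39] -/
theorem card_arcs_le (x : List α) : (arcs x).card ≤ 2 * x.length := by
  rw [card_arcs_eq, card_forwardArcs]
  have := card_backwardArcs_le x
  omega

/-- **The return triples are carried by backward arcs** (I. Simon, converse direction): for
`1 ≤ k ≤ |x|` with `a = x[pref[k]]`, the pair `(k + pref[k], a)` is a backward arc and its target is
at least `pref[k] + 1`; with `pref_shift_of_mem_backwardArcs`, the backward arc leaving `(p, a)` is the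
return triple `(p, a, j)` with the largest `j`. [cite: Simon1994StringMatching, Thm 2] -/
theorem mem_backwardArcs_of_pref {x : List α} {k : ℕ} {a : α} (hk : 0 < k) (hkx : k ≤ x.length)
    (ha : x[pref x k]? = some a) :
    (k + pref x k, a) ∈ backwardArcs x ∧ pref x k + 1 ≤ target x (k + pref x k) a := by
  set n := pref x k with hn_def
  have hn : n ≤ x.length - k := pref_le_length_sub x k
  have hnx : n < x.length := by omega
  -- the candidate `x[0..n] = x[0..n-1] a`, a suffix of `x[0..k+n-1] a`
  have hcand : x.take (n + 1) = x.take n ++ [a] := by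
    rw [List.take_add_one, ha]
    rfl
  have hdrop : (x.drop k).take n = x.take n :=
    (List.prefix_iff_eq_take.mp ((take_drop_prefix_iff_le_pref (by omega)).mpr le_rfl)).trans
      (by rw [List.length_take, List.length_drop, Nat.min_eq_left hn])
  have hsuf : x.take (n + 1) <:+ x.take (k + n) ++ [a] := by
    rw [hcand, List.take_add, hdrop, List.append_assoc]
    exact List.suffix_append _ _
  have hle : n + 1 ≤ target x (k + n) a := by
    have := length_le_target (List.take_prefix (n + 1) x) hsuf
    simp only [List.length_take] at this
    omega
  refine ⟨mem_backwardArcs_iff.mpr ⟨by show k + n ≤ x.length; omega,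
    by show 0 < target x (k + n) a; omega, ?_⟩, hle⟩
  show target x (k + n) a ≤ k + n
  have hts := target_le_succ x (k + n) a
  rcases hts.lt_or_eq with hlt | heq
  · omega
  · exfalso
    have hxa := (target_eq_succ_iff x (k + n) a).mp heq
    rcases pref_maximal (x := x) (k := k) (by omega) with hend | hne
    · rw [List.getElem?_eq_none (by omega)] at hxa
      cases hxa
    · exact hne (hxa.trans ha.symm)

/-! ### Outgoing degrees -/

/-- The **labeled successors** of the state `p` in `𝒟_D({x})`: the letters whose transition from `p`
does not enter the initial state. [cite: CrochemoreHancartLecroq2007, §2.7 (deg) and §1.4 (labeled successors)] -/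
def succLetters (x : List α) (p : ℕ) : Finset α :=
  x.toFinset.filter fun a => target x p a ≠ 0

/-- `deg_x(p)`: the **outgoing degree** of the state `p` in `𝒟_D({x})`. [cite: CrochemoreHancartLecroq2007, §2.7 (deg_u)] -/
def deg (x : List α) (p : ℕ) : ℕ := (succLetters x p).card

/-- `a` is a labeled successor letter of `p` iff `δ(p, a) ≠ ε`. [cite: CrochemoreHancartLecroq2007, §2.7 (deg_u)] -/
theorem mem_succLetters_iff {x : List α} {p : ℕ} {a : α} :
    a ∈ succLetters x p ↔ target x p a ≠ 0 := by
  simp only [succLetters, Finset.mem_filter, List.mem_toFinset, and_iff_right_iff_imp]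
  exact mem_of_target_ne_zero

/-- **Lemma 2.21**: the outgoing degree of a state is at most `card alph(x)`.
[cite: CrochemoreHancartLecroq2007, Lemma 2.21 and Thm 2.47] -/
theorem deg_le_card_toFinset (x : List α) (p : ℕ) : deg x p ≤ x.toFinset.card :=
  Finset.card_filter_le _ _

/-- The degrees count the arcs: `Σ_{p ≤ |x|} deg_x(p) = #arcs`. [cite: CrochemoreHancartLecroq2007, Thm 2.39 and Thm 2.41 (proof)] -/
theorem sum_deg_eq_card_arcs (x : List α) :
    ∑ p ∈ Finset.range (x.length + 1), deg x p = (arcs x).card := by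
  rw [arcs, Finset.card_filter, Finset.sum_product]
  refine Finset.sum_congr rfl fun p _ => ?_
  rw [deg, succLetters, Finset.card_filter]

/-- **Theorem 2.39, total**: the sum of the outgoing degrees of `𝒟_D({x})` is at most `2|x|`.
[cite: CrochemoreHancartLecroq2007, Thm 2.39] -/
theorem sum_deg_le (x : List α) : ∑ p ∈ Finset.range (x.length + 1), deg x p ≤ 2 * x.length := by
  rw [sum_deg_eq_card_arcs]
  exact card_arcs_le x

/-- **Lemma 2.44, `v = ε`**: the initial state has the single labeled successor `x[0]`.
[cite: CrochemoreHancartLecroq2007, Lemma 2.44] -/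
theorem deg_zero {x : List α} (hx : x ≠ []) : deg x 0 = 1 := by
  have h0 : 0 < x.length := List.length_pos_iff.mpr hx
  have hS : succLetters x 0 = {x[0]} := by
    ext a
    rw [mem_succLetters_iff, Finset.mem_singleton, target_zero, List.getElem?_eq_getElem h0]
    by_cases h : x[0] = a
    · subst h
      simp
    · simp [h, Ne.symm h]
  rw [deg, hS, Finset.card_singleton]

/-- **Lemma 2.44, terminal state**: `deg_x(x) = deg_x(Border(x))` — from `x` every letter takes the
failure link first. [cite: CrochemoreHancartLecroq2007, Lemma 2.44] -/
theorem deg_length {x : List α} (hx : x ≠ []) : deg x x.length = deg x (border x).length := by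
  have hS : succLetters x x.length = succLetters x (border x).length := by
    ext a
    rw [mem_succLetters_iff, mem_succLetters_iff,
      target_eq_target_border le_rfl (List.length_pos_iff.mpr hx) (by simp), List.take_length]
  rw [deg, deg, hS]

/-- **Lemma 2.44, inner states**: for `0 < p < |x|`,
`deg_x(x[0..p-1]) = deg_x(Border(x[0..p-1])) + [Border(x[0..p]) = ε]` — the state `p` has the forward
arc on `x[p]` and, on the other letters, the arcs of its failure state.
[cite: CrochemoreHancartLecroq2007, Lemma 2.44] -/
theorem deg_eq_deg_border_add {x : List α} {p : ℕ} (hp0 : 0 < p) (hp : p < x.length) :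
    deg x p = deg x (border (x.take p)).length + if border (x.take (p + 1)) = [] then 1 else 0 := by
  have ha : x[p]? = some x[p] := List.getElem?_eq_getElem hp
  set a := x[p]
  set q := (border (x.take p)).length with hq_def
  have hfw : target x p a = p + 1 := (target_eq_succ_iff x p a).mpr ha
  have hS : succLetters x p = insert a ((succLetters x q).erase a) := by
    ext b
    simp only [Finset.mem_insert, Finset.mem_erase, mem_succLetters_iff]
    by_cases hb : b = a
    · subst hb
      simp [hfw]
    · have hpb : x[p]? ≠ some b := by
        rw [ha]
        exact fun h => hb (Option.some.inj h).symm
      rw [target_eq_target_border hp.le hp0 hpb]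
      simp [hb, hq_def]
  have hqa : target x q a = (border (x.take (p + 1))).length := target_border_of_getElem? hp0 ha
  simp only [deg]
  rw [hS, Finset.card_insert_of_notMem (by simp), Finset.card_erase_eq_ite]
  by_cases hmem : a ∈ succLetters x q
  · have hne : border (x.take (p + 1)) ≠ [] := by
      intro e
      have := mem_succLetters_iff.mp hmem
      rw [hqa, e] at this
      exact this rfl
    have hpos : 0 < (succLetters x q).card := Finset.card_pos.mpr ⟨a, hmem⟩
    rw [if_pos hmem, if_neg hne]
    omega
  · have he : border (x.take (p + 1)) = [] := by
      have : target x q a = 0 := by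
        by_contra h
        exact hmem (mem_succLetters_iff.mpr h)
      rw [hqa] at this
      exact List.eq_nil_of_length_eq_zero this
    rw [if_neg hmem, if_pos he]

/-- **Lemma 2.45** (the cornerstone of the logarithmic bound): for a nonempty prefix `u = x[0..p-1]`
with `2|Border(u)| ≥ |u|`, `deg_x(Border(u)) = deg_x(Border²(u))` — by periodicity `Border(u)·x[|Border(u)|]`
has the nonempty border `u[0..k]`, `k = 2|Border(u)| - |u|`, so Lemma 2.44 adds nothing.
[cite: CrochemoreHancartLecroq2007, Lemma 2.45] -/
theorem deg_border_eq_deg_border_border {x : List α} {p : ℕ} (hp : p ≤ x.length) (hp0 : 0 < p)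
    (h2 : p ≤ 2 * (border (x.take p)).length) :
    deg x (border (x.take p)).length = deg x (border (border (x.take p))).length := by
  set u := x.take p with hu_def
  have hul : u.length = p := by simp [hu_def]; omega
  have hu : u ≠ [] := by
    intro e
    rw [e] at hul
    simp at hul
    omega
  set q := (border u).length with hq_def
  have hq : q < p := by
    have := length_border_lt hu
    omega
  have hq0 : 0 < q := by omega
  have hqx : q < x.length := by omega
  have ha : x[q]? = some x[q] := List.getElem?_eq_getElem hqx
  set a := x[q]
  have hBt : border u = x.take q := border_take_eq_take x p
  rw [deg_eq_deg_border_add hq0 hqx, ← hBt]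
  suffices hne : border (x.take (q + 1)) ≠ [] by rw [if_neg hne, Nat.add_zero]
  -- the period `per = p - q` of `u` and the witness `x[0..k-1] a`, `k = q - per`
  have hper : u.HasPeriod (p - q) := by
    have := (border_isBorder hu).hasPeriod
    rwa [hul] at this
  have key : ∀ i, i + (p - q) < p → x[i]? = x[i + (p - q)]? := by
    intro i hi
    have h1 := (List.hasPeriod_iff_getElem?.mp hper) i (by rw [hul]; omega)
    rw [hu_def, List.getElem?_take_of_lt (by omega), List.getElem?_take_of_lt hi] at h1
    exact h1
  have htake : x.take (q + 1) = border u ++ [a] := by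
    rw [List.take_add_one, ha, hBt]
    rfl
  rw [htake]
  set k := q - (p - q) with hk_def
  have hkq : k < q := by omega
  have hka : x[k]? = some a := by
    rw [key k (by omega), show k + (p - q) = q by omega, ha]
  have hw : IsBorder (x.take (k + 1)) (border u ++ [a]) := by
    refine ⟨?_, ?_, ?_⟩
    · rw [← htake]
      exact List.take_prefix_take_left (by omega)
    · have hk1 : x.take (k + 1) = x.take k ++ [a] := by
        rw [List.take_add_one, hka]
        rfl
      have hsplit : border u = x.take (p - q) ++ x.take k := by
        rw [hBt, show x.take q = x.take ((p - q) + k) by congr 1; omega, List.take_add]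
        congr 1
        apply List.ext_getElem?
        intro i
        rw [List.getElem?_take, List.getElem?_take]
        split_ifs with hi
        · rw [List.getElem?_drop, Nat.add_comm, ← key i (by omega)]
        · rfl
      rw [hk1, hsplit, List.append_assoc]
      exact List.suffix_append _ _
    · simp only [List.length_take, List.length_append, List.length_singleton,
        Nat.min_eq_left (show k + 1 ≤ x.length by omega)]
      omega
  intro e
  have := hw.length_le
  rw [e] at this
  simp only [List.length_take, List.length_nil] at this
  omega

/-- The descent behind Lemma 2.46: below a state of length `≤ p < 2^(i+1) - 1`, following failure
links from `Border(x[0..r-1])` does not change the degree until the length drops below `2^i - 1`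
(Lemma 2.45 at each step, equality (2.8)). [cite: CrochemoreHancartLecroq2007, Lemma 2.46 (proof, (2.8))] -/
theorem exists_deg_border_eq_of_lt_two_pow {x : List α} {p i : ℕ} (hi : 1 ≤ i)
    (hpi : p + 2 ≤ 2 ^ (i + 1)) :
    ∀ r, 0 < r → r ≤ p → r ≤ x.length →
      ∃ s, s + 1 < 2 ^ i ∧ s < r ∧ deg x (border (x.take r)).length = deg x s := by
  intro r
  induction r using Nat.strong_induction_on with
  | _ r ih =>
    intro hr0 hrp hrx
    set q := (border (x.take r)).length with hq_def
    have hrl : (x.take r).length = r := by simp; omega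
    have hne : x.take r ≠ [] := by
      intro e
      rw [e] at hrl
      simp at hrl
      omega
    have hqr : q < r := by
      have := length_border_lt hne
      omega
    by_cases hq : q + 1 < 2 ^ i
    · exact ⟨q, hq, hqr, rfl⟩
    · have h2i : 2 ^ (i + 1) = 2 * 2 ^ i := by rw [Nat.pow_succ]; omega
      have hq0 : 0 < q := by
        have : 2 ≤ 2 ^ i := by
          calc 2 = 2 ^ 1 := by norm_num
            _ ≤ 2 ^ i := Nat.pow_le_pow_right (by norm_num) hi
        omega
      have h45 := deg_border_eq_deg_border_border (x := x) hrx hr0 (by omega)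
      -- `Border(x[0..r-1]) = x[0..q-1]`
      have hBt : border (x.take r) = x.take q := border_take_eq_take x r
      have h45' : deg x q = deg x (border (x.take q)).length := by
        rw [← hBt]
        exact h45
      obtain ⟨s, hs1, hs2, hs3⟩ := ih q hqr hq0 (by omega) (by omega)
      exact ⟨s, hs1, by omega, h45'.trans hs3⟩

/-- **Lemma 2.46**: for a proper prefix `u = x[0..p-1]` of `x`, `deg_x(u) ≤ ⌊log₂(|u| + 1)⌋ + 1`.
[cite: CrochemoreHancartLecroq2007, Lemma 2.46; Hancart1993] -/
theorem deg_le_log (x : List α) : ∀ {p : ℕ}, p < x.length → deg x p ≤ Nat.log 2 (p + 1) + 1 := by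
  intro p
  induction p using Nat.strong_induction_on with
  | _ p ih =>
    intro hp
    have hx : x ≠ [] := List.ne_nil_of_length_pos (by omega)
    rcases Nat.eq_zero_or_pos p with rfl | hp0
    · rw [deg_zero hx]
      simp
    set i := Nat.log 2 (p + 1) with hi_def
    have hi1 : 1 ≤ i := Nat.log_pos (by norm_num) (by omega)
    have hup : p + 1 < 2 ^ (i + 1) := Nat.lt_pow_succ_log_self (by norm_num) _
    have h44 := deg_eq_deg_border_add (x := x) hp0 hp
    obtain ⟨s, hs1, hs2, hs3⟩ :=
      exists_deg_border_eq_of_lt_two_pow (x := x) hi1 (by omega) p hp0 le_rfl hp.le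
    have hs : deg x s ≤ Nat.log 2 (s + 1) + 1 := ih s hs2 (by omega)
    have hlog : Nat.log 2 (s + 1) < i := Nat.log_lt_of_lt_pow (by omega) hs1
    have hite : (if border (x.take (p + 1)) = [] then 1 else 0) ≤ 1 := by split_ifs <;> omega
    rw [h44, hs3]
    omega

/-- **Theorem 2.47** (Hancart): every state of `𝒟_D({x})` has outgoing degree at most
`min{card alph(x), 1 + ⌊log₂ |x|⌋}`. [cite: CrochemoreHancartLecroq2007, Thm 2.47; Hancart1993] -/
theorem deg_le (x : List α) {p : ℕ} (hp : p ≤ x.length) :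
    deg x p ≤ min x.toFinset.card (Nat.log 2 x.length + 1) := by
  refine le_min (deg_le_card_toFinset x p) ?_
  rcases eq_or_ne x [] with rfl | hx
  · simp only [List.length_nil, Nat.le_zero] at hp
    subst hp
    simp [deg, succLetters]
  rcases hp.lt_or_eq with hlt | rfl
  · have hmono := Nat.log_mono_right (b := 2) (show p + 1 ≤ x.length by omega)
    exact (deg_le_log x hlt).trans (by omega)
  · rw [deg_length hx]
    have hb := length_border_lt hx
    have hmono := Nat.log_mono_right (b := 2) (show (border x).length + 1 ≤ x.length by omega)
    exact (deg_le_log x hb).trans (by omega)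

/-! ### Optimality of Theorem 2.47: the strings `ξ(a₁ … a_{k-1}) a_k` -/

omit [DecidableEq α] in
/-- The function `ξ`: `ξ(ε) = ε`, `ξ(ua) = ξ(u)·a·ξ(u)` (sesquipowers; Zimin words on distinct
letters). [cite: CrochemoreHancartLecroq2007, §2.7 (function ξ); Simon1994StringMatching, §2 (sesquipowers)] -/
def xi (l : List α) : List α := l.foldl (fun z a => z ++ a :: z) []

omit [DecidableEq α] in
/-- `ξ(ε) = ε`. [cite: CrochemoreHancartLecroq2007, §2.7 (function ξ)] -/
@[simp] theorem xi_nil : xi ([] : List α) = [] := rfl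

omit [DecidableEq α] in
/-- `ξ(ua) = ξ(u) a ξ(u)`. [cite: CrochemoreHancartLecroq2007, §2.7 (function ξ)] -/
theorem xi_append_singleton (l : List α) (a : α) : xi (l ++ [a]) = xi l ++ a :: xi l := by
  simp [xi, List.foldl_append]

omit [DecidableEq α] in
/-- `|ξ(a₁…a_n)| = 2ⁿ - 1`. [cite: CrochemoreHancartLecroq2007, §2.7 (function ξ)] -/
theorem length_xi (l : List α) : (xi l).length + 1 = 2 ^ l.length := by
  induction l using List.reverseRecOn with
  | nil => simp
  | append_singleton l a ih =>
    rw [xi_append_singleton, List.length_append, List.length_cons, List.length_append,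
      List.length_singleton, Nat.pow_succ]
    omega

omit [DecidableEq α] in
/-- The letters of `ξ(u)` are those of `u`. [cite: CrochemoreHancartLecroq2007, §2.7 (function ξ)] -/
theorem mem_xi_iff {l : List α} {b : α} : b ∈ xi l ↔ b ∈ l := by
  induction l using List.reverseRecOn with
  | nil => simp
  | append_singleton l a ih =>
    rw [xi_append_singleton]
    simp only [List.mem_append, List.mem_cons, ih]
    tauto

omit [DecidableEq α] in
/-- `ξ(u)` is a prefix of `ξ(uv)`. [cite: CrochemoreHancartLecroq2007, §2.7 (function ξ)] -/
theorem xi_prefix_xi_append (l m : List α) : xi l <+: xi (l ++ m) := by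
  induction m using List.reverseRecOn with
  | nil => simp
  | append_singleton m b ih =>
    rw [← List.append_assoc, xi_append_singleton]
    exact ih.trans (List.prefix_append _ _)

omit [DecidableEq α] in
/-- `ξ(u)` is a suffix of `ξ(uv)`. [cite: CrochemoreHancartLecroq2007, §2.7 (function ξ)] -/
theorem xi_suffix_xi_append (l m : List α) : xi l <:+ xi (l ++ m) := by
  induction m using List.reverseRecOn with
  | nil => simp
  | append_singleton m b ih =>
    rw [← List.append_assoc, xi_append_singleton]
    exact ih.trans ⟨xi (l ++ m) ++ [b], by simp⟩

/-- **The bound of Theorem 2.47 is optimal**: if `ξ(a₁…a_{k-1}) a_k` is a prefix of `x` with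
`a₁, …, a_k` pairwise distinct, the state `ξ(a₁…a_{k-1})` (of length `2^{k-1} - 1`) has outgoing
degree exactly `k`: the forward arc on `a_k` and a backward arc on each `a_i`, `i < k`, entering
`ξ(a₁…a_{i-1}) a_i`. [cite: CrochemoreHancartLecroq2007, §2.7 (optimality of Thm 2.47, Fig. 2.15)] -/
theorem deg_length_xi {x : List α} {l : List α} {a : α} (hnd : (l ++ [a]).Nodup)
    (hx : xi l ++ [a] <+: x) : deg x (xi l).length = l.length + 1 := by
  have hxl : xi l <+: x := (List.prefix_append _ _).trans hx
  have hS : succLetters x (xi l).length = (l ++ [a]).toFinset := by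
    ext b
    rw [mem_succLetters_iff, List.mem_toFinset, List.mem_append, List.mem_singleton]
    constructor
    · intro hb
      have h1 := getElem?_of_target_pos (Nat.pos_of_ne_zero hb)
      have h2 := target_le_succ x (xi l).length b
      have hxt : x.take ((xi l).length + 1) = xi l ++ [a] := by
        have := List.prefix_iff_eq_take.mp hx
        simpa using this.symm
      have hmem : b ∈ x.take ((xi l).length + 1) := by
        refine List.mem_of_getElem? (i := target x (xi l).length b - 1) ?_
        rw [List.getElem?_take_of_lt (by omega)]
        exact h1
      rw [hxt] at hmem
      simpa [mem_xi_iff] using hmem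
    · rintro (hb | rfl)
      · obtain ⟨l₁, l₂, rfl⟩ := List.append_of_mem hb
        have hxt : x.take (xi (l₁ ++ b :: l₂)).length = xi (l₁ ++ b :: l₂) :=
          (List.prefix_iff_eq_take.mp hxl).symm
        have hsplit : l₁ ++ b :: l₂ = (l₁ ++ [b]) ++ l₂ := by simp
        have hpre : xi l₁ ++ [b] <+: x := by
          refine List.IsPrefix.trans ?_ hxl
          rw [hsplit]
          refine List.IsPrefix.trans ?_ (xi_prefix_xi_append (l₁ ++ [b]) l₂)
          rw [xi_append_singleton]
          exact ⟨xi l₁, by simp⟩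
        have hsuf : xi l₁ ++ [b] <:+ x.take (xi (l₁ ++ b :: l₂)).length ++ [b] := by
          rw [hxt]
          obtain ⟨r, hr⟩ := xi_suffix_xi_append l₁ (b :: l₂)
          exact ⟨r, by rw [← List.append_assoc, hr]⟩
        have := length_le_target hpre hsuf
        simp only [List.length_append, List.length_singleton] at this
        omega
      · rw [(target_eq_succ_iff x (xi l).length _).mpr ((prefix_append_singleton_iff hxl).mp hx)]
        omega
  rw [deg, hS, List.toFinset_card_of_nodup hnd]
  simp

/-! ### Examples (letters `a, b, c, d ↦ 0, 1, 2, 3`) -/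

section Examples

/-- Figure 2.15: `x = abacabad = ξ(abc)d`. [cite: CrochemoreHancartLecroq2007, Fig. 2.15] -/
example : xi [0, 1, 2] ++ [3] = [0, 1, 0, 2, 0, 1, 0, 3] := by decide

/-- Figure 2.15: the outgoing degrees of the states `0, …, 8` of `𝒟_D({abacabad})`; the maximum `4`
is reached in state `7 = ξ(abc)`, which is `1 + ⌊log₂ 8⌋` for a string on four letters.
[cite: CrochemoreHancartLecroq2007, Fig. 2.15] -/
example : (List.range 9).map (deg [0, 1, 0, 2, 0, 1, 0, 3]) = [1, 2, 1, 3, 1, 2, 1, 4, 1] := by decide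

example : Nat.log 2 8 + 1 = 4 := by
  rw [show (8 : ℕ) = 2 ^ 3 by norm_num, Nat.log_pow (by norm_num)]

/-- Simon's example `p = abacabadabacaba` (Fig. 1 of [Simon1994StringMatching]): `15` forward arcs and
exactly `15 = |p|` backward arcs — the bound of Theorem 2.39 is attained on sesquipowers.
[cite: Simon1994StringMatching, Fig. 1 and Thm 1] -/
example : (backwardArcs [0, 1, 0, 2, 0, 1, 0, 3, 0, 1, 0, 2, 0, 1, 0]).card = 15 := by decide

example : (forwardArcs [0, 1, 0, 2, 0, 1, 0, 3, 0, 1, 0, 2, 0, 1, 0]).card = 15 := by decide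

/-- From Simon's table (Fig. 1): in state `15` the letters `a, b, c, d` lead to `1, 2, 4, 8`.
[cite: Simon1994StringMatching, Fig. 1] -/
example : [0, 1, 2, 3].map (target [0, 1, 0, 2, 0, 1, 0, 3, 0, 1, 0, 2, 0, 1, 0] 15) = [1, 2, 4, 8] := by
  decide

/-- `x = abbb`: the backward arcs `(1,a), (2,a), (3,a), (4,a)` all enter state `1`, with the four
shifts `1, 2, 3, 4`. [cite: CrochemoreHancartLecroq2007, Lemma 2.20] -/
example : (backwardArcs [0, 1, 1, 1]).card = 4 ∧
    [1, 2, 3, 4].map (fun p => shift [0, 1, 1, 1] (p, 0)) = [1, 2, 3, 4] := by decide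

end Examples

end Literature.Computability.StringMatching
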